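/-
COR-CM (cell pub-hodgecm2, stage 2 of the Hodge ladder) — TRANSPOSITION SURGE, item (vi) pinning record, binder `hComp`
(REACH half), TEAM hComp row U4′a of `HOME/pinning/HCOMP-TABLE.md` v1: the PER-COMPONENT BALL UNIFORMISATION of a complex
algebraic model of `Sh_K(ℂ)`, TOPOLOGICAL HALF.  Seat prover-pub-hodgecm2-hcomp-compare-2-0 (`hcomp-compare-2`; path under the
pub-hodgecm2 lead's blanket pre-ACK for tabled `Transposition/HComp/<Name>.lean` files, one writer).  THEOREMS ONLY: no definition,
no instance, no named fact, nothing asserted; `CorCM/CM/Basic.lean`, `Interfaces.lean` (C1), every landed file untouched.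
FRAMING: HC_CM is NOT proved; nothing here discharges `hComp`/`hUnif`.
-/
import Summits.HodgeConjecture.CorCM.Geometry.FramedConeChart
import Literature.NumberTheory.Automorphic.UnitaryGroupCongruenceDiscontinuous
import Literature.AlgebraicGeometry.Motives.AlgPoints
import HarnessLib

/-!
# The ball uniformisation of one component of a complex model of `Sh_K(U(H), 𝔹²)(ℂ)` — topological half

Setting ([Deligne 1979] 2.1.2 read on an algebraic model, as in the tree's `ShimuraSetModelComponents.lean`): `L` a CM field,
`H ∈ M₃(L)`, `τ : L →+* ℂ` with a frame `T` (`formCongr ⋆ T H^τ = J`, i.e. `Tᴴ H^τ T = diag(1,1,-1)`), an arithmetic subgroup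
`Γ ≤ U(H)(L⁺)` (`Γ ≤ UnitaryGroup.rational …`; for the pieces of `Sh_K(ℂ)`, `Γ = Γ_H(gKg⁻¹) =
UnitaryGroup.arithmeticLevel … (K.map (MulAut.conj g))`), its image `Δ = T⁻¹ Γ^τ T ≤ U(2,1)` (`UnitaryGroup.archImageU21`), a
complex scheme `E` (a component of the model) with a homeomorphism `φ : E(ℂ) ≃ₜ Δ\𝔹²` onto the ball quotient
(`Deligne1979.exists_components_homeomorph_ballQuotient`), its open immersion `ι : E ⟶ X` into the model, and a map
`u : ℂ³ → X(ℂ)` with `u(T·(z,1)) = ι(φ⁻¹[z])` and `u(c • v) = u(v)` on the negative cone (the first two conjuncts of the clause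
`hol` of the canonical-model record `UnitaryCanonicalModel.Record` / `RecordSystem`, `UnitaryShimuraCanonicalModel.lean`, read
through `ι ∘ φ⁻¹`).

Main results (namespace `Summit.HodgeConjecture.CorCM.HComp`):

* `map_mulVec_mem_negCone` — `Γ^τ` preserves the negative cone of `H^τ`;
* `archRepU21_smul_coneChart` — the lattice acts on the framed cone chart through `Γ`: `(T⁻¹γ^τT) • proj(T⁻¹v) = proj(T⁻¹ γ^τ v)`;
* `pieceProj_eq_iff` — FIBRES of `v ↦ Δ · proj(T⁻¹ v)`: two cone vectors have the same image in `Δ\𝔹²` iff `γ^τ v = c • w`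
  for some `γ ∈ Γ`, `c ≠ 0` (the fibre clause `unif_eq_unif_iff` of the tree's `UnitaryBallUniformisationDatum`, read in `L`);
* **`exists_pieceUnif`** — the uniformisation `unif : ℂ³ → E(ℂ)` of the component: `unif (T·(z,1)) = φ⁻¹[z]`,
  `ι ∘ unif = u` on the cone, and the four TOPOLOGICAL clauses of `UnitaryBallUniformisationDatum` (`continuousOn_unif`,
  `isOpenMap_unif`, `surjOn_unif`, `unif_eq_unif_iff` with the group `Γ` read through `τ`).

The holomorphy clause (`differentiableOn_unif`, from the third conjunct of the record's `hol` restricted along the open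
immersion `ι`), smoothness, and the packaging into a `UnitaryBallUniformisationDatum 2 E` with `E := τ(L)`, `Hℂ = H^τ`,
`Γ^{τ₁} = Γ^τ` (algebraic half = the tree's `PicardCode.ofHermitian`) are row U4′b (`HComp/ComponentBallDatumHol.lean`); the
clause `ι ∘ unif = u` of `exists_pieceUnif` is its input.  Everything below is PROVED; 0 hypothesis binders of Prop-valued
named facts (T5: n/a).

References: P. Deligne, *Variétés de Shimura*, Proc. Symp. Pure Math. 33.2 (1979), 2.1.2; J. S. Milne, *Introduction to Shimura
varieties* (2005), Lemma 5.13; N. Bergeron, J. Millson, C. Moeglin, Acta Math. 216 (2016), Introduction §1.1, Part 2 §§1.2–1.3;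
A. Borel, H. Jacquet, Proc. Symp. Pure Math. 33.1 (1979) §4.1.
-/

set_option autoImplicit false

noncomputable section

open scoped Matrix Topology ComplexOrder
open Set Function MulAction Matrix NumberField
open Literature.Geometry.ComplexHyperbolic
open Literature.Geometry.ComplexHyperbolic.BallModel (U21 Ball proj lift mat x₀)
open Literature.NumberTheory.Automorphic
open Literature.NumberTheory.Automorphic.UnitaryGroup
open Literature.AlgebraicGeometry.ShimuraVarieties (negCone mem_negCone_iff isOpen_negCone smul_mem_negCone)
open Literature.AlgebraicGeometry.Motives (SchemeOver ComplexPoints AlgPoints)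
open Summit.HodgeConjecture.CorCM.FramedCone

namespace Summit.HodgeConjecture.CorCM.HComp

variable (L : Type) [Field L] [NumberField L] [IsCMField L] (H : Matrix (Fin 3) (Fin 3) L)
  (τ : L →+* ℂ) (T : GL (Fin 3) ℂ)

/-! ## 1. The frame and the action of `Γ^τ` on the negative cone -/

omit [NumberField L] [IsCMField L] in
/-- The frame hypothesis of the record (`formCongr ⋆ T H^τ = J`) in product form `Tᴴ H^τ T = J` (the shape consumed by the
framed cone chart `FramedCone.coneChart`). [folklore] -/
theorem frame_J_of_formCongr (hT : formCongr (starRingEnd ℂ) T (H.map τ) = BallModel.J) :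
    (T : Matrix (Fin 3) (Fin 3) ℂ)ᴴ * H.map τ * (T : Matrix (Fin 3) (Fin 3) ℂ) = BallModel.J := by
  rw [← formCongr_star]; exact hT

/-- **Isometries preserve the negative cone**: for `γ ∈ U(H)(L⁺)` (`UnitaryGroup.rational`) and `v` in the negative cone of
`H^τ`, `γ^τ v` is again negative (`(γ^τ)ᴴ H^τ γ^τ = H^τ`). [cite: BergeronMillsonMoeglin2016Balls, Part 2 §1.2] -/
theorem map_mulVec_mem_negCone {γ : GL (Fin 3) L}
    (hγ : γ ∈ rational (↥(maximalRealSubfield L)) L (IsCMField.complexConj L) 3 H) {v : Fin 3 → ℂ}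
    (hv : v ∈ negCone (H.map τ)) :
    ((γ : Matrix (Fin 3) (Fin 3) L).map τ) *ᵥ v ∈ negCone (H.map τ) := by
  have hu := conjTranspose_map_mul_map_of_mem_rational L H τ hγ
  rw [mem_negCone_iff] at hv ⊢
  rw [star_mulVec, mulVec_mulVec, dotProduct_mulVec, vecMul_vecMul, ← Matrix.mul_assoc, hu,
    ← dotProduct_mulVec]
  exact hv

variable (hT : formCongr (starRingEnd ℂ) T (H.map τ) = BallModel.J) {Γ : Subgroup (GL (Fin 3) L)}

/-- **The lattice acts on the framed cone chart through `Γ`**: `ρ_T(γ) • coneChart v = coneChart (γ^τ v)` for `γ ∈ Γ`,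
`ρ_T(γ) = T⁻¹ γ^τ T` (`UnitaryGroup.archRepU21`, `mat_archRepU21`; `FramedCone.smul_coneChart`).
[cite: BergeronMillsonMoeglin2016Balls, Part 2 §1.3] [cite: BorelJacquet1979, §4.1] -/
theorem archRepU21_smul_coneChart
    (hΓ : Γ ≤ rational (↥(maximalRealSubfield L)) L (IsCMField.complexConj L) 3 H) (γ : Γ) (v : negCone (H.map τ)) :
    archRepU21 L H τ T hT hΓ γ • coneChart T (frame_J_of_formCongr L H τ T hT) v =
      coneChart T (frame_J_of_formCongr L H τ T hT)
        ⟨(((γ : GL (Fin 3) L) : Matrix (Fin 3) (Fin 3) L).map τ) *ᵥ (v : Fin 3 → ℂ),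
          map_mulVec_mem_negCone L H τ (hΓ γ.2) v.2⟩ :=
  smul_coneChart T (frame_J_of_formCongr L H τ T hT) _ (mat_archRepU21 L H τ T hT hΓ γ) v _

/-! ## 2. Fibres of the projection `negCone H^τ → Δ\𝔹²`, `v ↦ Δ · proj (T⁻¹ v)` -/

/-- **Fibres of the piece projection are the `Γ·ℂˣ`-orbits.**  For cone vectors `v`, `w`: the classes of `proj(T⁻¹v)` and
`proj(T⁻¹w)` in `Δ\𝔹²`, `Δ = archImageU21 … Γ = {T⁻¹γ^τT}`, agree iff `γ^τ v = c • w` for some `γ ∈ Γ` and `c ≠ 0` — the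
fibre clause `unif_eq_unif_iff` of `UnitaryBallUniformisationDatum`, with the group read in `L` through `τ`.
[cite: BergeronMillsonMoeglin2016Balls, Introduction §1.1] [cite: Milne2005ShimuraVarieties, Lemma 5.13] -/
theorem pieceProj_eq_iff
    (hΓ : Γ ≤ rational (↥(maximalRealSubfield L)) L (IsCMField.complexConj L) 3 H) (v w : negCone (H.map τ)) :
    (Quotient.mk'' (coneChart T (frame_J_of_formCongr L H τ T hT) v) :
        orbitRel.Quotient (archImageU21 L H τ T hT Γ) Ball) =
      Quotient.mk'' (coneChart T (frame_J_of_formCongr L H τ T hT) w) ↔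
      ∃ γ ∈ Γ, ∃ c : ℂ, c ≠ 0 ∧
        ((γ : Matrix (Fin 3) (Fin 3) L).map τ) *ᵥ (v : Fin 3 → ℂ) = c • (w : Fin 3 → ℂ) := by
  have hJ := frame_J_of_formCongr L H τ T hT
  rw [eq_comm]
  change Literature.Geometry.Manifold.QuotientManifold.mk (G := archImageU21 L H τ T hT Γ) (coneChart T hJ w) =
      Literature.Geometry.Manifold.QuotientManifold.mk (coneChart T hJ v) ↔ _
  rw [Quotient.eq]
  change coneChart T hJ w ∈ MulAction.orbit (archImageU21 L H τ T hT Γ) (coneChart T hJ v) ↔ _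
  rw [MulAction.mem_orbit_iff]
  constructor
  · rintro ⟨δ, hδ⟩
    obtain ⟨γ, hγδ⟩ := exists_archRepU21_eq_of_mem_archImageU21 L H τ T hT hΓ δ.2
    rw [Subgroup.smul_def, ← hγδ, archRepU21_smul_coneChart L H τ T hT hΓ γ v, coneChart_eq_iff] at hδ
    obtain ⟨c, hc, hcw⟩ := hδ
    exact ⟨γ, γ.2, c, hc, hcw⟩
  · rintro ⟨γ, hγ, c, hc, hcw⟩
    refine ⟨⟨archRepU21 L H τ T hT hΓ ⟨γ, hγ⟩, archRepU21_mem_archImageU21 L H τ T hT hΓ ⟨γ, hγ⟩⟩, ?_⟩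
    rw [Subgroup.smul_def]
    change archRepU21 L H τ T hT hΓ ⟨γ, hγ⟩ • coneChart T hJ v = coneChart T hJ w
    rw [archRepU21_smul_coneChart L H τ T hT hΓ ⟨γ, hγ⟩ v, coneChart_eq_iff]
    exact ⟨c, hc, hcw⟩

/-! ## 3. The uniformisation of a component -/

/-- **The ball uniformisation of one component of a complex model of `Sh_K(ℂ)`, topological half.**  Let `E` be a complex
scheme with a homeomorphism `φ : E(ℂ) ≃ₜ Δ\𝔹²` onto the quotient of the tree's ball by the lattice `Δ = T⁻¹Γ^τT` of an
arithmetic `Γ ≤ U(H)(L⁺)` (a component of a smooth projective model of `Sh_K(ℂ)`,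
`Deligne1979.exists_components_homeomorph_ballQuotient`, with `Γ = Γ_H(g_qKg_q⁻¹)`), `ι : E ⟶ X` a morphism into the model and
`u : ℂ³ → X(ℂ)` a map with `u(T·(z,1)) = ι(φ⁻¹[z])` for `z ∈ 𝔹²` and `u(c • v) = u(v)` on the negative cone of `H^τ` (the record's
clause `hol`, first two conjuncts, `UnitaryCanonicalModel.Record.hol` / `RecordSystem.hol`).  Then there is `unif : ℂ³ → E(ℂ)`
(junk off the cone) with: `unif (T·(z,1)) = φ⁻¹[z]`; `ι ∘ unif = u` ON THE CONE (the input of the holomorphy transfer, row U4′b);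
and the four topological clauses of the tree's `UnitaryBallUniformisationDatum` — continuous on the cone, open on the cone
(`𝔹² → Δ\𝔹²` is open for any subgroup `Δ ≤ U(2,1)`, Mathlib `isOpenMap_quotient_mk'_mul`; the framed chart is open,
`FramedCone.isOpenMap_coneChart`), onto `E(ℂ)`, and with fibres exactly the `Γ·ℂˣ`-orbits: `unif v = unif w ↔ ∃ γ ∈ Γ, ∃ c ≠ 0,
γ^τ v = c • w` (`pieceProj_eq_iff`).  Construction: `unif v = φ⁻¹ (Δ · proj(T⁻¹ v))`.  No properness, freeness or holomorphy is
used or asserted here. [cite: Deligne1979ShimuraVarieties, §2.1.2] [cite: Milne2005ShimuraVarieties, Lemma 5.13]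
[cite: BergeronMillsonMoeglin2016Balls, Introduction §1.1 and Part 2 §1.3] -/
theorem exists_pieceUnif
    (hΓ : Γ ≤ rational (↥(maximalRealSubfield L)) L (IsCMField.complexConj L) 3 H)
    {X E : SchemeOver ℂ} (ι : E ⟶ X)
    (φ : ComplexPoints E ≃ₜ orbitRel.Quotient (archImageU21 L H τ T hT Γ) Ball)
    (u : (Fin 3 → ℂ) → ComplexPoints X)
    (hu₁ : ∀ z : Ball, u ((T : Matrix (Fin 3) (Fin 3) ℂ) *ᵥ lift z) = AlgPoints.map ι (φ.symm (Quotient.mk'' z)))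
    (hu₂ : ∀ v ∈ negCone (H.map τ), ∀ c : ℂ, c ≠ 0 → u (c • v) = u v) :
    ∃ unif : (Fin 3 → ℂ) → ComplexPoints E,
      (∀ z : Ball, unif ((T : Matrix (Fin 3) (Fin 3) ℂ) *ᵥ lift z) = φ.symm (Quotient.mk'' z)) ∧
      (∀ v ∈ negCone (H.map τ), AlgPoints.map ι (unif v) = u v) ∧
      ContinuousOn unif (negCone (H.map τ)) ∧
      IsOpenMap ((negCone (H.map τ)).restrict unif) ∧
      Set.SurjOn unif (negCone (H.map τ)) Set.univ ∧
      ∀ v ∈ negCone (H.map τ), ∀ w ∈ negCone (H.map τ),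
        unif v = unif w ↔ ∃ γ ∈ Γ, ∃ c : ℂ, c ≠ 0 ∧ ((γ : Matrix (Fin 3) (Fin 3) L).map τ) *ᵥ v = c • w := by
  classical
  have hJ := frame_J_of_formCongr L H τ T hT
  -- the piece projection `p : cone → Δ\𝔹²`, `v ↦ Δ · proj (T⁻¹ v)`, and `unif := φ⁻¹ ∘ p` extended by junk
  set p : negCone (H.map τ) → orbitRel.Quotient (archImageU21 L H τ T hT Γ) Ball :=
    fun v => Quotient.mk'' (coneChart T hJ v) with hp_def
  set unif : (Fin 3 → ℂ) → ComplexPoints E := fun v =>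
    if hv : v ∈ negCone (H.map τ) then φ.symm (p ⟨v, hv⟩) else φ.symm (Quotient.mk'' x₀) with hunif_def
  have hunif : ∀ {v : Fin 3 → ℂ} (hv : v ∈ negCone (H.map τ)), unif v = φ.symm (p ⟨v, hv⟩) := fun hv => by
    simp only [hunif_def, dif_pos hv]
  have hres : (negCone (H.map τ)).restrict unif = φ.symm ∘ p := by
    funext v
    rw [Set.restrict_apply, Function.comp_apply, hunif v.2]
  -- `p` is continuous, open, onto
  have hp_cont : Continuous p := continuous_quotient_mk'.comp (continuous_coneChart T hJ)
  have hp_open : IsOpenMap p :=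
    (isOpenMap_quotient_mk'_mul (Γ := ↥(archImageU21 L H τ T hT Γ)) (T := Ball)).comp (isOpenMap_coneChart T hJ)
  have hp_surj : Surjective p := by
    intro q
    obtain ⟨z, rfl⟩ := Quotient.exists_rep q
    obtain ⟨v, hv⟩ := coneChart_surjective T hJ z
    exact ⟨v, by simp only [hp_def, hv]⟩
  -- clause 1: the section vectors
  have h1 : ∀ z : Ball, unif ((T : Matrix (Fin 3) (Fin 3) ℂ) *ᵥ lift z) = φ.symm (Quotient.mk'' z) := by
    intro z
    rw [hunif (t_mulVec_lift_mem T hJ z)]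
    change φ.symm (Quotient.mk'' (coneChart T hJ (coneLift T hJ z))) = _
    rw [coneChart_coneLift]
  refine ⟨unif, h1, ?_, ?_, ?_, ?_, ?_⟩
  · -- clause 2: `ι ∘ unif = u` on the cone
    intro v hv
    have h2 : ((ti T *ᵥ v) 2) ≠ 0 := BallModel.ne_zero_of_Q_neg (Q_ti_mulVec_neg T hJ hv)
    have hw : (T : Matrix (Fin 3) (Fin 3) ℂ) *ᵥ lift (coneChart T hJ ⟨v, hv⟩) ∈ negCone (H.map τ) :=
      t_mulVec_lift_mem T hJ _
    calc AlgPoints.map ι (unif v)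
        = AlgPoints.map ι (φ.symm (Quotient.mk'' (coneChart T hJ ⟨v, hv⟩))) := by rw [hunif hv]
      _ = u ((T : Matrix (Fin 3) (Fin 3) ℂ) *ᵥ lift (coneChart T hJ ⟨v, hv⟩)) := (hu₁ _).symm
      _ = u (((ti T *ᵥ v) 2) • ((T : Matrix (Fin 3) (Fin 3) ℂ) *ᵥ lift (coneChart T hJ ⟨v, hv⟩))) :=
          (hu₂ _ hw _ h2).symm
      _ = u v := by rw [smul_t_mulVec_lift_coneChart T hJ ⟨v, hv⟩]
  · -- clause 3: continuity on the cone
    rw [continuousOn_iff_continuous_restrict, hres]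
    exact φ.symm.continuous.comp hp_cont
  · -- clause 4: openness on the cone
    rw [hres]
    exact φ.symm.isOpenMap.comp hp_open
  · -- clause 5: onto
    intro P _
    obtain ⟨v, hv⟩ := hp_surj (φ P)
    refine ⟨v, v.2, ?_⟩
    rw [hunif v.2, Subtype.coe_eta, hv, Homeomorph.symm_apply_apply]
  · -- clause 6: fibres
    intro v hv w hw
    rw [hunif hv, hunif hw, φ.symm.injective.eq_iff]
    exact pieceProj_eq_iff L H τ T hT hΓ ⟨v, hv⟩ ⟨w, hw⟩

end Summit.HodgeConjecture.CorCM.HComp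

end
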